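import Mathlib.Analysis.Calculus.Deriv.Polynomial
import Mathlib.Analysis.SpecialFunctions.Pow.Deriv
import Mathlib.NumberTheory.DirichletCharacter.Bounds
import Mathlib.NumberTheory.LSeries.Injectivity
import Literature.NumberTheory.GaloisRepresentations.ArtinDirichletCoefficients
import Literature.NumberTheory.GaloisRepresentations.FramedRepTwistEulerFactorProofs
import Literature.NumberTheory.GaloisRepresentations.ArtinLFunctionNonvanishingProofs
import HarnessLib

/-!
# Naive Dirichlet-character twists of the Dirichlet series of an Artin L-function over `ℚ`
(pure proofs; sequel to `Literature.NumberTheory.GaloisRepresentations.ArtinDirichletCoefficients`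
and `Literature.NumberTheory.GaloisRepresentations.FramedRepTwistEulerFactorProofs`)

A. R. Booker, *Poles of Artin L-functions and the strong Artin conjecture*, Ann. of Math. 158
(2003), proof of Lemma 1, p. 1093: after the finite Fourier expansion (7) of the additive
twist, "the inner sum [`∑_{(r, p) = 1} a_r χ(r) r^{-s}`] is `L(s, ρ ⊗ χ₀ ⊗ χ)`, with the Euler
factor at `p` removed".  This file proves the general form of that remark: for a framed Artin
representation `σ : Γ_ℚ → GL_n(ℂ)` with Dirichlet coefficients `a_m`
(`ArtinRep.dirichletCoeff`, `∑ a_m m^{-s} = L(s, σ)` on `Re s > 1`), a Dirichlet character `χ`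
mod `N ≥ 1` of any level (possibly imprimitive), and the twist `π = σ ⊗ χ`
(`π(g) = χ(χ_N(g)) · σ(g)`, `FramedRep.exists_twist` with `dirichletGaloisCharacter ℚ χ`), the
NAIVE twist `∑ a_m χ(m) m^{-s}` is `L(s, π)` with the Euler factors at the primes `p ∣ N`
removed:

* `FramedArtinRep.LSeries_dirichletCoeff_mul_mul_prod_eq_artinLFunction` (**main, proved**): for
  `Re s > 1`,
  `(∑_m a_m χ(m) m^{-s}) · ∏_{p ∣ N} L_p(π, p^{-s})⁻¹ = L(s, π)`;
* `FramedArtinRep.exists_differentiable_LSeries_mul_dirichlet_eq_mul_artinLFunction` — the form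
  consumed by Booker's Lemma 1 (`LFunctions.Booker2003_lemma1_of_charTwist_continuation`): for
  ANY `a` with `∑ a_m m^{-s} = L(s, σ)` on `Re s > 1` there is an entire `E` (namely
  `E(s) = ∏_{p ∣ N} L_p(π, p^{-s})`, a polynomial in the `p^{-s}`) with
  `∑ a_m χ(m) m^{-s} = E(s) L(s, π)` for `Re s > 1`;
* `ArtinRep.eq_dirichletCoeff_of_LSeries_eq_artinLFunction` — uniqueness of the Dirichlet
  coefficients: any such `a` agrees with `dirichletCoeff σ` on `m ≥ 1` (`L(s, σ) ≠ 0` on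
  `Re s > 1` forces absolute convergence; Mathlib `LSeries.eq_of_LSeries_eventually_eq`).

**Proof of the main identity** (Booker, loc. cit.; Neukirch VII §10 (10.1) for the Euler
product).  The summands `a_m χ(m) m^{-s}` are multiplicative in `m`, so Mathlib's
`EulerProduct.eulerProduct_hasProd` gives `∑ a_m χ(m) m^{-s} = ∏_p A_p`,
`A_p = ∑_k c_p(k) (χ(p) p^{-s})^k = L_p(σ, χ(p) p^{-s})⁻¹` (`ArtinRep.tsum_localCoeff_mul_pow`,
`|χ(p) p^{-s}| < 1`).  For `p ∤ N`, `L_p(π, T) = L_p(σ, χ(p) T)`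
(`FramedRep.eval_eulerFactorAt_of_twist_dirichlet`: `χ_N` is unramified at `p` with
`χ_N(Frob_p) = p`), so `A_p = L_p(π, p^{-s})⁻¹`; for `p ∣ N`, `χ(p) = 0` and `A_p = 1`.  Hence
`∏_p L_p(π, p^{-s})⁻¹ = (∏_p A_p) · ∏_{p ∣ N} L_p(π, p^{-s})⁻¹` (Mathlib `HasProd.mul` with a
finitely supported factor), and the left side is `L(s, π)` (`artinLFunction`, reindexed along
`Rat.HeightOneSpectrum.primesEquiv`, `N v = p`).

No definition and no named fact is introduced (D-0026); theorems only.

## References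

* A. R. Booker, Ann. of Math. (2) 158 (2003), 1089–1098: proof of Lemma 1, p. 1093. [Booker2003]
* J. Neukirch, *Algebraic Number Theory* (1999), VII §10, (10.1) and the remark following it.
  [NeukirchANT1999]
* P. Deligne, J.-P. Serre, *Formes modulaires de poids 1*, Ann. Sci. ÉNS (4) 7 (1974), 4.4
  (twists by Dirichlet characters) and §9. [DeligneSerreASENS1974]

## Mathlib / tree search

Mathlib (this pin): `EulerProduct.eulerProduct_hasProd`, `HasProd.mul`,
`hasProd_prod_of_ne_finset_one`, `DirichletCharacter.norm_le_one`, `ZMod.isUnit_iff_coprime`,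
`MulChar.map_nonunit` (`χ(p) = 0` for `p ∣ N`, as in the tree's
`Automorphic.dirichletCharacter_apply_eq_zero_of_prime_dvd` of `LanglandsTunnellLSeriesProofs`, not
imported here), `LSeries.eq_of_LSeries_eventually_eq`,
`LSeries.abscissaOfAbsConv_le_of_forall_lt_LSeriesSummable`.  Tree: `ArtinRep.dirichletCoeff`,
`ArtinRep.tsum_localCoeff_mul_pow`, `ArtinRep.LSeriesSummable_dirichletCoeff`,
`ArtinRep.LSeries_dirichletCoeff_eq_artinLFunction`, `ArtinRep.eval_eulerFactorAt_ne_zero_of_norm_lt_one`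
(`ArtinDirichletCoefficients`); `FramedRep.eval_eulerFactorAt_of_twist_dirichlet`
(`FramedRepTwistEulerFactorProofs`); `artinLFunction_ne_zero_of_one_lt_re`
(`ArtinLFunctionNonvanishingProofs`); `lean search 'dirichletCoeff_mul|twist.*LSeries|LSeries.*twist'`:
no statement about character twists of `dirichletCoeff` before this file.
-/

noncomputable section

open scoped NumberField
open Field IsDedekindDomain Module NumberField Polynomial Complex Filter Finset
open Rat.HeightOneSpectrum

namespace Literature.NumberTheory.GaloisRepresentations

universe w

/-! ### Uniqueness of the Dirichlet coefficients -/

namespace ArtinRep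

variable {V : Type w} [AddCommGroup V] [Module ℂ V] [TopologicalSpace V] [FiniteDimensional ℂ V]
  [IsModuleTopology ℂ V]

/-- **Uniqueness of the Dirichlet coefficients of `L(s, ρ)`** (the sense in which Booker 2003,
(4), speaks of "the" Dirichlet coefficients `a_n` of `L(s, ρ)`): if `∑ a_m m^{-s} = L(s, ρ)`
for `Re s > 1` (Mathlib `LSeries`, junk value `0` where divergent), then `a_m = dirichletCoeff ρ m`
for every `m ≥ 1`, and `∑ a_m m^{-s}` converges absolutely on `Re s > 1`.  Indeed
`L(s, ρ) ≠ 0` there (`artinLFunction_ne_zero_of_one_lt_re`), so the series of `a` converges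
(absolutely); two absolutely convergent Dirichlet series with the same sum on a right half-line
have the same coefficients (`LSeries.eq_of_LSeries_eventually_eq`).
[cite: Booker2003, eq. (4) p. 1091] -/
theorem eq_dirichletCoeff_of_LSeries_eq_artinLFunction (ρ : ArtinRep ℚ V) {a : ℕ → ℂ}
    (ha : ∀ s : ℂ, 1 < s.re → LSeries a s = artinLFunction ρ s) :
    (∀ m : ℕ, m ≠ 0 → a m = ρ.dirichletCoeff m) ∧ ∀ s : ℂ, 1 < s.re → LSeriesSummable a s := by
  have hasum : ∀ s : ℂ, 1 < s.re → LSeriesSummable a s := by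
    intro s hs
    by_contra h
    have h0 : LSeries a s = 0 := tsum_eq_zero_of_not_summable h
    exact artinLFunction_ne_zero_of_one_lt_re ρ hs ((ha s hs).symm.trans h0)
  have habs : ∀ f : ℕ → ℂ, (∀ s : ℂ, 1 < s.re → LSeriesSummable f s) →
      LSeries.abscissaOfAbsConv f < ⊤ := by
    intro f hf
    refine lt_of_le_of_lt (LSeries.abscissaOfAbsConv_le_of_forall_lt_LSeriesSummable
      (x := 1) fun y hy => hf y ?_) (EReal.coe_lt_top 1)
    simpa using hy
  have hev : (fun x : ℝ => LSeries a x) =ᶠ[atTop] fun x => LSeries ρ.dirichletCoeff x := by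
    filter_upwards [eventually_gt_atTop (1 : ℝ)] with x hx
    have hx' : 1 < (x : ℂ).re := by simpa using hx
    rw [ha x hx', ρ.LSeries_dirichletCoeff_eq_artinLFunction hx']
  refine ⟨fun m hm => ?_, hasum⟩
  exact LSeries.eq_of_LSeries_eventually_eq (habs a hasum)
    (habs _ fun s hs => ρ.LSeriesSummable_dirichletCoeff hs) hev hm

end ArtinRep

/-! ### The naive twist by a Dirichlet character -/

namespace FramedArtinRep

variable {n N : ℕ} [NeZero N]

omit [NeZero N] in
/-- `|χ(p) p^{-s}| < 1` for a prime `p` and `Re s > 0` (in fact `≤ p^{-Re s}`). [folklore] -/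
theorem norm_dirichlet_mul_cpow_lt_one (χ : DirichletCharacter ℂ N) (p : Nat.Primes) {s : ℂ}
    (hs : 0 < s.re) : ‖χ ((p : ℕ) : ZMod N) * ((p : ℕ) : ℂ) ^ (-s)‖ < 1 := by
  have hp : (p : ℕ).Prime := p.2
  have hz : ‖((p : ℕ) : ℂ) ^ (-s)‖ < 1 := by
    rw [Complex.norm_natCast_cpow_of_pos hp.pos, Complex.neg_re]
    exact Real.rpow_lt_one_of_one_lt_of_neg (by exact_mod_cast hp.one_lt) (by linarith)
  rw [norm_mul]
  calc ‖χ ((p : ℕ) : ZMod N)‖ * ‖((p : ℕ) : ℂ) ^ (-s)‖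
      ≤ 1 * ‖((p : ℕ) : ℂ) ^ (-s)‖ :=
        mul_le_mul_of_nonneg_right (χ.norm_le_one _) (norm_nonneg _)
    _ < 1 := by rw [one_mul]; exact hz

/-- **The naive character twist of the Dirichlet series of `L(s, σ)` is `L(s, σ ⊗ χ)` with the
Euler factors at `p ∣ N` removed** (Booker 2003, proof of Lemma 1, p. 1093: "`∑ a_r χ(r) r^{-s}`
… is `L(s, ρ ⊗ χ₀ ⊗ χ)`, with the Euler factor at `p` removed").  Let `σ : Γ_ℚ → GL_n(ℂ)` be a
framed Artin representation with Dirichlet coefficients `a_m = dirichletCoeff σ m`, `χ` a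
Dirichlet character mod `N ≥ 1`, and `π` its twist `π(g) = χ(χ_N(g)) · σ(g)` by the Galois
character of `χ` (`dirichletGaloisCharacter`).  Then for `Re s > 1`
`(∑_m a_m χ(m) m^{-s}) · ∏_{p ∣ N} L_p(π, p^{-s})⁻¹ = L(s, π)`,
the product over the primes `p ∣ N` (as the finset `N.primeFactors.subtype Nat.Prime` of
`Nat.Primes`; `L_p = ArtinRep.eulerFactorAt` at the place `primesEquiv.symm p`).  Proof: Euler
product of the multiplicative summands (`EulerProduct.eulerProduct_hasProd`) with local factors
`∑_k c_p(k) (χ(p) p^{-s})^k = L_p(σ, χ(p) p^{-s})⁻¹` (`ArtinRep.tsum_localCoeff_mul_pow`), equal to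
`L_p(π, p^{-s})⁻¹` for `p ∤ N` (`FramedRep.eval_eulerFactorAt_of_twist_dirichlet`) and to `1` for
`p ∣ N` (`χ(p) = 0`). [cite: Booker2003, proof of Lemma 1 p. 1093]
[cite: NeukirchANT1999, VII §10, (10.1)] -/
theorem LSeries_dirichletCoeff_mul_mul_prod_eq_artinLFunction (χ : DirichletCharacter ℂ N)
    {σ π : FramedArtinRep ℚ n}
    (hπ : ∀ g, π g = Matrix.GeneralLinearGroup.scalar (Fin n) (dirichletGaloisCharacter ℚ χ g) * σ g)
    {s : ℂ} (hs : 1 < s.re) :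
    LSeries (fun m : ℕ => σ.toArtinRep.dirichletCoeff m * χ (m : ZMod N)) s *
        ∏ p ∈ (N.primeFactors.subtype Nat.Prime : Finset Nat.Primes),
          ((π.toArtinRep.eulerFactorAt ((primesEquiv (R := 𝓞 ℚ)).symm p)).eval
            (((p : ℕ) : ℂ) ^ (-s)))⁻¹ =
      artinLFunction π.toArtinRep s := by
  set g : ℕ → ℂ := fun m : ℕ => σ.toArtinRep.dirichletCoeff m * χ (m : ZMod N) with hg
  -- the summands `a_m χ(m) m^{-s}` and their multiplicativity
  set G : ℕ → ℂ := LSeries.term g s with hG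
  have hGT : ∀ m : ℕ, G m = LSeries.term σ.toArtinRep.dirichletCoeff s m * χ (m : ZMod N) :=
    fun m => by
    rcases eq_or_ne m 0 with rfl | hm
    · simp only [hG, LSeries.term_zero, zero_mul]
    · simp only [hG, hg, LSeries.term_of_ne_zero hm]
      ring
  obtain ⟨hT1, hTmul⟩ := σ.toArtinRep.term_dirichletCoeff_mul_of_coprime s
  have hG1 : G 1 = 1 := by rw [hGT, hT1, Nat.cast_one, map_one, mul_one]
  have hG0 : G 0 = 0 := LSeries.term_zero g s
  have hGmul : ∀ {m k : ℕ}, m.Coprime k → G (m * k) = G m * G k := fun {m k} hmk => by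
    rw [hGT, hGT, hGT, hTmul hmk, Nat.cast_mul, map_mul]
    ring
  have hTsum : Summable fun m => ‖LSeries.term σ.toArtinRep.dirichletCoeff s m‖ :=
    summable_norm_iff.mpr (σ.toArtinRep.LSeriesSummable_dirichletCoeff hs)
  have hGsum : Summable fun m => ‖G m‖ := by
    refine hTsum.of_nonneg_of_le (fun _ => norm_nonneg _) fun m => ?_
    rw [hGT, norm_mul]
    calc ‖LSeries.term σ.toArtinRep.dirichletCoeff s m‖ * ‖χ (m : ZMod N)‖
        ≤ ‖LSeries.term σ.toArtinRep.dirichletCoeff s m‖ * 1 :=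
          mul_le_mul_of_nonneg_left (χ.norm_le_one _) (norm_nonneg _)
      _ = ‖LSeries.term σ.toArtinRep.dirichletCoeff s m‖ := mul_one _
  have hEP := EulerProduct.eulerProduct_hasProd hG1 hGmul hGsum hG0
  -- the local factors `A_p = L_p(σ, χ(p) p^{-s})⁻¹`
  set A : Nat.Primes → ℂ := fun p =>
    ((σ.toArtinRep.eulerFactorAt ((primesEquiv (R := 𝓞 ℚ)).symm p)).eval
      (χ ((p : ℕ) : ZMod N) * ((p : ℕ) : ℂ) ^ (-s)))⁻¹ with hA
  have hloc : ∀ p : Nat.Primes, ∑' k : ℕ, G ((p : ℕ) ^ k) = A p := fun p => by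
    have hp : (p : ℕ).Prime := p.2
    have hz := norm_dirichlet_mul_cpow_lt_one χ p (s := s) (by linarith)
    simp only [hA]
    rw [← σ.toArtinRep.tsum_localCoeff_mul_pow ((primesEquiv (R := 𝓞 ℚ)).symm p) hz]
    refine tsum_congr fun k => ?_
    have hk0 : ((p : ℕ) ^ k : ℕ) ≠ 0 := pow_ne_zero k hp.ne_zero
    rw [hGT, LSeries.term_of_ne_zero hk0, σ.toArtinRep.dirichletCoeff_prime_pow hp k,
      Subtype.coe_eta, div_eq_mul_inv, ← Complex.cpow_neg]
    simp only [Nat.cast_pow, map_pow]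
    rw [← Complex.natCast_cpow_natCast_mul, mul_pow, ← Complex.cpow_nat_mul]
    ring
  have hLg : HasProd A (LSeries g s) := by
    have h := hEP
    simp only [hloc] at h
    exact h
  -- the Euler factors `B_p = L_p(π, p^{-s})⁻¹` of `L(s, π)` and the finitely many corrections
  set B : Nat.Primes → ℂ := fun p =>
    ((π.toArtinRep.eulerFactorAt ((primesEquiv (R := 𝓞 ℚ)).symm p)).eval
      (((p : ℕ) : ℂ) ^ (-s)))⁻¹ with hB
  set S : Finset Nat.Primes := N.primeFactors.subtype Nat.Prime with hS
  have hmemS : ∀ p : Nat.Primes, p ∈ S ↔ (p : ℕ) ∣ N := fun p => by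
    have h : p ∈ S ↔ (p : ℕ) ∈ N.primeFactors := Finset.mem_subtype
    rw [h, Nat.mem_primeFactors]
    exact ⟨fun h => h.2.1, fun h => ⟨p.2, h, NeZero.ne N⟩⟩
  set C : Nat.Primes → ℂ := fun p => if (p : ℕ) ∣ N then B p else 1 with hC
  have hAB : ∀ p : Nat.Primes, ¬ (p : ℕ) ∣ N → A p = B p := fun p hpN => by
    have hv : ¬ (primesEquiv (R := 𝓞 ℚ) ((primesEquiv (R := 𝓞 ℚ)).symm p) : ℕ) ∣ N := by
      rwa [Equiv.apply_symm_apply]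
    simp only [hA, hB]
    rw [FramedRep.eval_eulerFactorAt_of_twist_dirichlet χ hπ hv, Equiv.apply_symm_apply]
  have hA1 : ∀ p : Nat.Primes, (p : ℕ) ∣ N → A p = 1 := fun p hpN => by
    -- `χ(p) = 0` for `p ∣ N` (the tree's `Automorphic.dirichletCharacter_apply_eq_zero_of_prime_dvd`,
    -- inlined to keep the modular-forms cone out of the imports)
    have hχp : χ ((p : ℕ) : ZMod N) = 0 := χ.map_nonunit fun hu =>
      (Nat.Prime.coprime_iff_not_dvd p.2).1 ((ZMod.isUnit_iff_coprime _ _).1 hu) hpN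
    simp only [hA]
    rw [hχp, zero_mul,
      ← Polynomial.coeff_zero_eq_eval_zero, ArtinRep.eulerFactorAt_coeff_zero, inv_one]
  have hBAC : ∀ p : Nat.Primes, B p = A p * C p := fun p => by
    by_cases hpN : (p : ℕ) ∣ N
    · simp only [hC, hpN, ↓reduceIte]
      rw [hA1 p hpN, one_mul]
    · simp only [hC, hpN, ↓reduceIte]
      rw [hAB p hpN, mul_one]
  have hCprod : HasProd C (∏ p ∈ S, B p) := by
    have h1 : ∏ p ∈ S, B p = ∏ p ∈ S, C p :=
      Finset.prod_congr rfl fun p hp => by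
        simp only [hC, (hmemS p).1 hp, ↓reduceIte]
    rw [h1]
    refine hasProd_prod_of_ne_finset_one fun p hp => ?_
    simp only [hC, show ¬ (p : ℕ) ∣ N from fun h => hp ((hmemS p).2 h), ↓reduceIte]
  have hBprod : HasProd B (LSeries g s * ∏ p ∈ S, B p) := by
    have h := hLg.mul hCprod
    rw [show (fun p : Nat.Primes => A p * C p) = B from funext fun p => (hBAC p).symm] at h
    exact h
  -- `L(s, π)` is the product of the `B_p` over the rational primes
  have hL : artinLFunction π.toArtinRep s = ∏' p : Nat.Primes, B p := by
    simp only [hB]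
    unfold artinLFunction
    rw [← Equiv.tprod_eq (primesEquiv (R := 𝓞 ℚ)).symm]
    refine tprod_congr fun p => ?_
    rw [Rat.residueCard_eq_natGenerator', Rat.natGenerator_primesEquiv_symm]
  rw [hL, hBprod.tprod_eq]
  rfl

/-- **Naive character twists of the Dirichlet coefficients of `L(s, σ)`, existential form**
(the input of `LFunctions.Booker2003_lemma1_of_charTwist_continuation`).  For `σ : Γ_ℚ → GL_n(ℂ)`,
ANY `a` with `∑ a_m m^{-s} = L(s, σ)` on `Re s > 1`, a Dirichlet character `χ` mod `N ≥ 1` and the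
twist `π(g) = χ(χ_N(g)) · σ(g)`, there is an entire function `E` — namely
`E(s) = ∏_{p ∣ N} L_p(π, p^{-s})`, a polynomial in the finitely many `p^{-s}` — with
`∑ a_m χ(m) m^{-s} = E(s) · L(s, π)` for `Re s > 1`: `a = dirichletCoeff σ` on `m ≥ 1`
(`ArtinRep.eq_dirichletCoeff_of_LSeries_eq_artinLFunction`), then
`LSeries_dirichletCoeff_mul_mul_prod_eq_artinLFunction` and `L_p(π, p^{-s}) ≠ 0`
(`ArtinRep.eval_eulerFactorAt_ne_zero_of_norm_lt_one`).  Booker 2003, proof of Lemma 1, p. 1093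
("with the Euler factor at `p` removed"; there recombined with `E_p(s)`).
[cite: Booker2003, proof of Lemma 1 p. 1093] -/
theorem exists_differentiable_LSeries_mul_dirichlet_eq_mul_artinLFunction
    (χ : DirichletCharacter ℂ N) {σ π : FramedArtinRep ℚ n}
    (hπ : ∀ g, π g = Matrix.GeneralLinearGroup.scalar (Fin n) (dirichletGaloisCharacter ℚ χ g) * σ g)
    {a : ℕ → ℂ} (ha : ∀ s : ℂ, 1 < s.re → LSeries a s = artinLFunction σ.toArtinRep s) :
    ∃ E : ℂ → ℂ, Differentiable ℂ E ∧ ∀ s : ℂ, 1 < s.re →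
      LSeries (a * fun m : ℕ => χ (m : ZMod N)) s = E s * artinLFunction π.toArtinRep s := by
  obtain ⟨hab, -⟩ := σ.toArtinRep.eq_dirichletCoeff_of_LSeries_eq_artinLFunction ha
  -- `x = y (x z)` whenever `y z = 1`
  have key : ∀ x y z : ℂ, y * z = 1 → x = y * (x * z) := fun x y z h => by
    rw [mul_left_comm, h, mul_one]
  refine ⟨fun s => ∏ p ∈ (N.primeFactors.subtype Nat.Prime : Finset Nat.Primes),
      (π.toArtinRep.eulerFactorAt ((primesEquiv (R := 𝓞 ℚ)).symm p)).eval (((p : ℕ) : ℂ) ^ (-s)),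
    ?_, fun s hs => ?_⟩
  · refine Differentiable.fun_finsetProd fun p _ => ?_
    have hp0 : ((p : ℕ) : ℂ) ≠ 0 := Nat.cast_ne_zero.2 p.2.ne_zero
    exact (Polynomial.differentiable _).comp (differentiable_id.neg.const_cpow (Or.inl hp0))
  · have hcongr : LSeries (a * fun m : ℕ => χ (m : ZMod N)) s =
        LSeries (fun m : ℕ => σ.toArtinRep.dirichletCoeff m * χ (m : ZMod N)) s :=
      LSeries_congr (fun {m} hm => by simp only [Pi.mul_apply, hab m hm]) s
    have hne : ∀ p ∈ (N.primeFactors.subtype Nat.Prime : Finset Nat.Primes),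
        (π.toArtinRep.eulerFactorAt ((primesEquiv (R := 𝓞 ℚ)).symm p)).eval
          (((p : ℕ) : ℂ) ^ (-s)) ≠ 0 := fun p _ => by
      refine π.toArtinRep.eval_eulerFactorAt_ne_zero_of_norm_lt_one _ ?_
      have hp : (p : ℕ).Prime := p.2
      rw [Complex.norm_natCast_cpow_of_pos hp.pos, Complex.neg_re]
      exact Real.rpow_lt_one_of_one_lt_of_neg (by exact_mod_cast hp.one_lt) (by linarith)
    have hEinv : (∏ p ∈ (N.primeFactors.subtype Nat.Prime : Finset Nat.Primes),
        (π.toArtinRep.eulerFactorAt ((primesEquiv (R := 𝓞 ℚ)).symm p)).eval (((p : ℕ) : ℂ) ^ (-s))) *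
        ∏ p ∈ (N.primeFactors.subtype Nat.Prime : Finset Nat.Primes),
          ((π.toArtinRep.eulerFactorAt ((primesEquiv (R := 𝓞 ℚ)).symm p)).eval
            (((p : ℕ) : ℂ) ^ (-s)))⁻¹ = 1 := by
      rw [← Finset.prod_mul_distrib]
      exact Finset.prod_eq_one fun p hp => mul_inv_cancel₀ (hne p hp)
    rw [hcongr, ← LSeries_dirichletCoeff_mul_mul_prod_eq_artinLFunction χ hπ hs]
    exact key _ _ _ hEinv

end FramedArtinRep

end Literature.NumberTheory.GaloisRepresentations

end
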